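import Summits.BirchSwinnertonDyer.BirchSwinnertonDyer.Theses.RamifiedSevenEllipticUnits
import Summits.BirchSwinnertonDyer.Rank1Residual.Additive.QuadraticBranchOddStrictSelmer
import Literature.NumberTheory.EllipticCurves.QuadraticTwistSelmerPInfty
import Literature.NumberTheory.EllipticCurves.BSDSelmer
import HarnessLib

set_option linter.dupNamespace false
set_option autoImplicit false

/-!
# Route `RamifiedSevenEllipticUnits` (rung K7r), crux `StrictControlSeven` (stmt-BirchSwinnertonDyer-19145):
# the STRICT local condition and the strict `p^∞`-Selmer group under isomorphisms of curves
# (brick (s1)/(s7) of the twist-descent step)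

Cell `bsd-cm`, seat `bsd-cm-k7r-c4` (g0). HONEST FRAMING: nothing here closes the crux; BSD is not
proved by any of this. By `…StrictControlDescent`, crux #4 is the twist-descent identity (D) for
the STRICT `7^∞`-Selmer groups; its right-hand side names `strictSelmerPInfty W' 7` for the frame
twin `W' = C • W^{(−7)}`, a curve ISOMORPHIC over `ℚ` to the quadratic twist. This file supplies the
invariance of the strict local condition and of `#Sel_str(·/ℚ)[p^∞]` under such isomorphisms — the
strict companion of the tree's `mem_selmerLocalKerPrimary_iff_h1PrimaryIso_mem` /
`selmerGroupPInftyIso` (`QuadraticTwistSelmerPInfty`, Silverman X.§4: Selmer groups are attached to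
`E/K`, not to an equation).

## What is proved

* `mem_selmerLocalKerPrimaryTorsion_iff_h1PrimaryIso_mem` — for Weierstrass curves `W₁, W₂` over a
  field `K` with `V • W₁ = W₂`, a prime `p` and any `K`-field `E`: a class of `H¹(K, E₁[p^∞])` dies in
  `H¹(E, E₁(K̄_E)[p^∞])` iff its image under `h1PrimaryIso` dies in `H¹(E, E₂(K̄_E)[p^∞])`
  (`mem_resKer_iff_h1Equiv_mem` on the local square `pointsMap_twistPointsIso`, restricted to
  `p`-primary parts by `primaryComponentCongr`).
* `mem_strictSelmerPInfty_iff_h1PrimaryIso_mem`, `natCard_strictSelmerPInfty_eq_of_variableChange` —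
  over `ℚ`: `Sel_str(W₁/ℚ)[p^∞] ≅ Sel_str(W₂/ℚ)[p^∞]`, in particular equal orders.
* `natCard_strictSelmerPInfty_quadraticTwist_mul_sq` — `#Sel_str(W^{(d e²)}/ℚ)[p^∞] =
  #Sel_str(W^{(d)}/ℚ)[p^∞]` (`W^{(d e²)} ≅ W^{(d)}`, `exists_variableChange_quadraticTwist_mul_sq`).

References: [SilvermanAEC2009] X.§4 (Remark 4.1.1), III.3.1(b); [Skinner2020] §2.2 (the strict group).
-/

noncomputable section

open scoped Classical

open WeierstrassCurve
  Literature.NumberTheory.EllipticCurves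
  Literature.NumberTheory.GaloisRepresentations
  Summit.BirchSwinnertonDyer.Rank1Residual.Additive

universe u

namespace Summit.BirchSwinnertonDyer.BirchSwinnertonDyer.Theorems.RamifiedSevenEllipticUnits

/-! ## §1 The strict local condition under `V • W₁ = W₂` -/

section Iso

variable {K : Type u} [Field K] {W₁ W₂ : WeierstrassCurve K} {V : VariableChange K}
  (E : Type u) [Field E] [Algebra K E] (p : ℕ)

/-- **The STRICT (`p^∞`-torsion-coefficient) local conditions of isomorphic curves correspond** at
every `K`-field `E`: `s` dies in `H¹(E, E₁(K̄_E)[p^∞])` iff `h1PrimaryIso p hV s` dies in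
`H¹(E, E₂(K̄_E)[p^∞])`. [cite: SilvermanAEC2009, X.§4 (Remark 4.1.1)] -/
theorem mem_selmerLocalKerPrimaryTorsion_iff_h1PrimaryIso_mem (hV : V • W₁ = W₂)
    (s : galH1Primary W₁ p) :
    s ∈ selmerLocalKerPrimaryTorsion W₁ E p ↔
      h1PrimaryIso p hV s ∈ selmerLocalKerPrimaryTorsion W₂ E p :=
  mem_resKer_iff_h1Equiv_mem (resGal (K := K) E) (primaryPointsMap W₁ E p)
    (primaryPointsMap_smul W₁ E p) (primaryPointsMap W₂ E p) (primaryPointsMap_smul W₂ E p)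
    (primaryIso p hV) (primaryIso_smul p hV)
    (primaryComponentCongr (twistLocalIso E hV) p)
    (fun g m ↦ Subtype.ext (by
      rw [coe_primaryComponentCongr, primaryComponent.coe_smul, primaryComponent.coe_smul,
        coe_primaryComponentCongr, twistLocalIso_smul]))
    (fun m ↦ Subtype.ext (pointsMap_twistPointsIso E hV (m : geomPoints W₁))) s

end Iso

/-! ## §2 The strict `p^∞`-Selmer group over `ℚ` under `V • W₁ = W₂` -/

section Rat

variable {W₁ W₂ : WeierstrassCurve ℚ} {V : VariableChange ℚ} (p : ℕ) [Fact p.Prime]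

/-- **`Sel_str(W₁/ℚ)[p^∞]` and `Sel_str(W₂/ℚ)[p^∞]` correspond under `h1PrimaryIso`** for
`V • W₁ = W₂` (the classical conditions by `mem_selmerGroupPInfty_iff_h1PrimaryIso_mem`, the strict
condition at `ℚ_p` by §1). [cite: SilvermanAEC2009, X.§4 (Remark 4.1.1)] [cite: Skinner2020, §2.2] -/
theorem mem_strictSelmerPInfty_iff_h1PrimaryIso_mem (hV : V • W₁ = W₂) (s : galH1Primary W₁ p) :
    s ∈ strictSelmerPInfty W₁ p ↔ h1PrimaryIso p hV s ∈ strictSelmerPInfty W₂ p := by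
  rw [strictSelmerPInfty_def, strictSelmerPInfty_def, AddSubgroup.mem_inf, AddSubgroup.mem_inf,
    mem_selmerGroupPInfty_iff_h1PrimaryIso_mem p hV s,
    mem_selmerLocalKerPrimaryTorsion_iff_h1PrimaryIso_mem ℚ_[p] p hV s]

/-- **Isomorphic curves over `ℚ` have strict `p^∞`-Selmer groups of the same order** (`Nat.card`).
[cite: SilvermanAEC2009, X.§4 (Remark 4.1.1)] [cite: Skinner2020, §2.2] -/
theorem natCard_strictSelmerPInfty_eq_of_variableChange (hV : V • W₁ = W₂) :
    Nat.card ↥(strictSelmerPInfty W₁ p) = Nat.card ↥(strictSelmerPInfty W₂ p) := by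
  refine Nat.card_congr
    { toFun := fun s ↦ ⟨h1PrimaryIso p hV s, (mem_strictSelmerPInfty_iff_h1PrimaryIso_mem p hV _).mp s.2⟩
      invFun := fun t ↦ ⟨(h1PrimaryIso p hV).symm t, by
        have h := mem_strictSelmerPInfty_iff_h1PrimaryIso_mem p hV ((h1PrimaryIso p hV).symm t)
        rw [AddEquiv.apply_symm_apply] at h
        exact h.mpr t.2⟩
      left_inv := fun s ↦ Subtype.ext ((h1PrimaryIso p hV).symm_apply_apply _)
      right_inv := fun t ↦ Subtype.ext ((h1PrimaryIso p hV).apply_symm_apply _) }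

end Rat

/-- **`#Sel_str(W^{(d e²)}/ℚ)[p^∞] = #Sel_str(W^{(d)}/ℚ)[p^∞]`** for `e ≠ 0` (the twists by `d` and
`d e²` are isomorphic over `ℚ`, `exists_variableChange_quadraticTwist_mul_sq`).
[cite: SilvermanAEC2009, X.§4 (Remark 4.1.1) and X.5 Cor. 5.4] -/
theorem natCard_strictSelmerPInfty_quadraticTwist_mul_sq (W : WeierstrassCurve ℚ)
    (p : ℕ) [Fact p.Prime] (d : ℚ) {e : ℚ} (he : e ≠ 0) :
    Nat.card ↥(strictSelmerPInfty (W.quadraticTwist (d * e ^ 2)) p) =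
      Nat.card ↥(strictSelmerPInfty (W.quadraticTwist d) p) := by
  obtain ⟨C, hC⟩ := W.exists_variableChange_quadraticTwist_mul_sq d e he
  exact (natCard_strictSelmerPInfty_eq_of_variableChange p hC).symm

end Summit.BirchSwinnertonDyer.BirchSwinnertonDyer.Theorems.RamifiedSevenEllipticUnits

end
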